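import Literature.NumberTheory.GaloisCohomology.Howard2004.DualityDatumLocalCupScalarReadingProofs
import Literature.NumberTheory.GaloisRepresentations.ContinuousCohomologyConnecting
import HarnessLib

/-!
# `H²(K_v, R(1))` has a rank-one socle: the hypothesis (hP) of the Lagrangian algebra for Howard's local
# pairing module, from the `ℤ/p^k`-readings of a dualizing family (proofs file)

Topic `NumberTheory/GaloisCohomology/Howard2004`. THEOREMS ONLY: no definition, no named fact, no instance, no
notation, no `sorry`. Cell `pub/bsd-print-x9`, print leaf G87
`Literature.NumberTheory.GaloisCohomology.Howard2004.thm161_dvrKolyvaginBound` (Howard Thm. 1.6.1); seat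
`bsd-line-x9-p1-w4` g16, brick (hP).

SOURCE / WHY. B. Howard, *The Heegner point Kolyvagin system*, Compositio Math. **140** (2004) = arXiv:1202.6340,
§1.3 H.4 (p. 7 L78–82): the induced local pairing `⟨ , ⟩_v : H¹(K_v, T) × H¹(K_v̄, T) → R` takes values in the level
ring `R` — Howard composes the cup product `∪_e` to `H²(K_v, R(1))` with the invariant map, `H²(K_v, R(1)) ≅ R`
(local class field theory, Milne I Cor. 2.3, `R(1) ≅ ⊕ μ`).  Lemma 1.5.7 (p. 10 L105–127) uses that the target is
`R` («an `R`-valued pairing … `≅ (R/𝔪^δ)²`»).  The tree's Lagrangian algebra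
(`Algebra/Module/LagrangianSubmodulesDeltaTransfer.forall_pow_smul_eq_zero_of_lagrangian`) abstracts the target to
an `R`-module `P` with the ONE property it needs, (hP): «the `ϖ`-torsion of `P` has rank `≤ 1`», i.e.
`ϖ p = 0 → ϖ q = 0 → p ≠ 0 → q ∈ R p`.  This file proves (hP) for `P = H²(K_v, R(1))` with the functorial scalar
action `H²(r•) = galoisCohomology.scalarMap … 2 r` (ring axioms: `GaloisCohomologyScalarActionDegreeTwoProofs`), from
the same property of `R` itself, by reading `H²(K_v, R(1))` into `R` through the characters `exp ∘ λ_b`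
(`λ_b = λ(b ·)`) of a dualizing family — the kernel form of «`H²(K_v, R(1)) ≅ R`».

WHAT IS PROVED (H.4 datum `D : DualityDatum p cd ρ R`, `(λ, exp)` as in `DualityDatumTateDualBridge` with `exp`
injective, a dualizing family `(r_i)` of `R` (`x ↦ (exp λ(r_i x))_i` bijective) which SPANS `R` additively
(`b = ∑ n_i • r_i`; automatic for a basis of a free `ℤ/p^k`-module, e.g. `[T^i]` in `A_{m,k}`), and an injective
`ι_v = inv_v : H²(K_v, μ_{p^k}) → ℤ/p^k`):
* §0 (characters of the level ring, no Galois module): `lamMul_lamMul` (`(λ_b)_a = λ_{ba}`), `lamMul_add`,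
  `add_semilinear`, `eq_zero_of_forall_lam_mul_eq_zero` (`λ(r_i c) = 0 ∀ i ⇒ c = 0`), **`exists_eq_lamMul`** (every additive
  `φ : R → ℤ/p^k` is some `λ_c`: `c ↦ λ_c` is injective and `#Hom(R, ℤ/p^k) = #R`, tree `Nat.card_addMonoidHom_zmod`);
* §1 `cohomologyMap_expLamLocalHom_congr` (the reading depends on `λ` only), **`cohomologyMap_expLam_add`**
  (`H²(exp ∘ (λ₁+λ₂)) z = H²(exp ∘ λ₁) z + H²(exp ∘ λ₂) z`, on `2`-cocycles), `cohomologyMap_expLam_lamMul_scalarMap_two`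
  (`H²(exp ∘ λ_b)(H²(a•) z) = H²(exp ∘ λ_{b a}) z`);
* §3 **`exists_forall_reading_eq_lam_mul`**: every `z ∈ H²(K_v, R(1))` has a COORDINATE `c ∈ R` with
  `ι H²(exp ∘ λ_b) z = λ(c b)` for all `b ∈ R`; `eq_of_forall_reading_eq` (classes with the same readings on the family
  are equal);
* §4 **`exists_eq_scalarMap_two_of_scalarMap_two_eq_zero`** = (hP) for `H²(K_v, R(1))`: if the `ϖ`-torsion of `R`
  has rank `≤ 1` (`ϖ a = 0 → ϖ b = 0 → a ≠ 0 → b ∈ R a`, e.g. `R = 𝒪/ϖ^e`), then for `P, Q ∈ H²(K_v, R(1))` killed by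
  `H²(ϖ•)` with `P ≠ 0` there is `c ∈ R` with `Q = H²(c•) P`.

NOT HERE: `inv_v` (the Poitou–Tate binder `IsPerfect`), the dualizing family of a given level ring, the `Module R`
packaging of `H²(K_v, R(1))` (its `smul` unfolds to `scalarMap … 2` by `rfl`); `thm161_dvrKolyvaginBound` is NOT
proved; no summit statement is proved; the Birch–Swinnerton-Dyer conjecture is not proved by any of this.
References: [Howard2004HeegnerKolyvagin] §1.3 H.4, Lemma 1.5.7; [MilneADT2006] I Cor. 2.3; [SerreGaloisCohomology1997]
I §2.2–2.3 (functoriality of `H²` in the coefficients, factor systems).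
-/

set_option autoImplicit false

noncomputable section

open CategoryTheory Function NumberField IsDedekindDomain Field
open scoped ContRepresentation NumberField

namespace Literature.NumberTheory.GaloisCohomology.Howard2004

open Literature.NumberTheory.GaloisRepresentations
open Literature.NumberTheory.GaloisRepresentations.DiscreteGaloisModule

/-! ## §0 Characters of the level ring (no Galois module involved) -/

namespace DualityDatum

section Characters

variable {R : Type} [CommRing R] {p : ℕ} {k : ℕ}

/-- `(λ_b)_a = λ_{b a}`. [cite: Howard2004HeegnerKolyvagin, §1.3 H.4 (arXiv p. 7, L78–82)] -/
theorem lamMul_lamMul (lam : R →+ ZMod (p ^ k)) (b a : R) : lamMul (lamMul lam b) a = lamMul lam (b * a) := by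
  refine AddMonoidHom.ext fun x => ?_
  rw [lamMul_apply, lamMul_apply, lamMul_apply, mul_assoc]

/-- `λ_{b + b'} = λ_b + λ_{b'}`. [cite: Howard2004HeegnerKolyvagin, §1.3 H.4 (arXiv p. 7, L78–82)] -/
theorem lamMul_add (lam : R →+ ZMod (p ^ k)) (b b' : R) : lamMul lam (b + b') = lamMul lam b + lamMul lam b' := by
  refine AddMonoidHom.ext fun x => ?_
  rw [AddMonoidHom.add_apply, lamMul_apply, lamMul_apply, lamMul_apply, add_mul, map_add]

/-- The sum of two `ℤ_p`-semilinear characters is semilinear. [cite: Howard2004HeegnerKolyvagin, §1.3 H.4 (arXiv p. 7, L78–82)] -/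
theorem add_semilinear [Fact p.Prime] [Algebra ℤ_[p] R] {lam₁ lam₂ : R →+ ZMod (p ^ k)}
    (h₁ : ∀ (z : ℤ_[p]) (r : R), lam₁ (algebraMap ℤ_[p] R z * r) = PadicInt.toZModPow k z * lam₁ r)
    (h₂ : ∀ (z : ℤ_[p]) (r : R), lam₂ (algebraMap ℤ_[p] R z * r) = PadicInt.toZModPow k z * lam₂ r)
    (z : ℤ_[p]) (r : R) : (lam₁ + lam₂) (algebraMap ℤ_[p] R z * r) = PadicInt.toZModPow k z * (lam₁ + lam₂) r := by
  rw [AddMonoidHom.add_apply, AddMonoidHom.add_apply, h₁, h₂, mul_add]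

/-- `λ(r_i c) = 0` for all `i` forces `c = 0` (injectivity half of a dualizing family `x ↦ (exp λ(r_i x))_i`).
[cite: Howard2004HeegnerKolyvagin, §1.3 H.4 (arXiv p. 7, L78–82: «perfect»)] -/
theorem eq_zero_of_forall_lam_mul_eq_zero {N : Type} [AddCommGroup N] (lam : R →+ ZMod (p ^ k)) (exp : ZMod (p ^ k) →+ N)
    {ι : Type} (r : ι → R) (hbij : Bijective fun x : R => fun i : ι => exp (lam (r i * x))) (c : R)
    (hc : ∀ i, lam (r i * c) = 0) : c = 0 := by
  apply hbij.1
  funext i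
  change exp (lam (r i * c)) = exp (lam (r i * 0))
  simp only [hc i, mul_zero, map_zero]

/-- **Every additive character `φ : R → ℤ/p^k` is `λ_c = λ(c ·)` for some `c ∈ R`** (`R` finite, killed by `p^k`,
`(r_i)` dualizing): `c ↦ λ_c` is injective and `#Hom(R, ℤ/p^k) = #R` (tree `Nat.card_addMonoidHom_zmod`).
[cite: Howard2004HeegnerKolyvagin, §1.3 H.4 and §2.1 (arXiv p. 13, L20–24: «Hom_{S_𝔭}(N, 𝒟_𝔭(1)) ≅ Hom_{ℤ_p}(N, μ_{p^∞})»)] [cite: MilneADT2006, Ch. I §0 (duals of finite groups)] -/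
theorem exists_eq_lamMul [Fact p.Prime] [Finite R] {N : Type} [AddCommGroup N] (lam : R →+ ZMod (p ^ k))
    (exp : ZMod (p ^ k) →+ N) (hR : ∀ x : R, (p ^ k) • x = 0) {ι : Type} (r : ι → R)
    (hbij : Bijective fun x : R => fun i : ι => exp (lam (r i * x))) (φ : R →+ ZMod (p ^ k)) :
    ∃ c : R, φ = lamMul lam c := by
  haveI : NeZero (p ^ k) := ⟨pow_ne_zero k (Fact.out : p.Prime).ne_zero⟩
  haveI : Finite (R →+ ZMod (p ^ k)) :=
    Finite.of_injective (fun f : R →+ ZMod (p ^ k) => (f : R → ZMod (p ^ k))) DFunLike.coe_injective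
  -- `c ↦ λ_c` is injective, hence bijective by counting
  have hinj : Injective fun c : R => lamMul lam c := fun c c' h => by
    rw [← sub_eq_zero]
    refine eq_zero_of_forall_lam_mul_eq_zero lam exp r hbij _ fun i => ?_
    have := DFunLike.congr_fun h (r i)
    rw [lamMul_apply, lamMul_apply, mul_comm c, mul_comm c'] at this
    rw [mul_sub, map_sub, sub_eq_zero, this]
  obtain ⟨c, hc⟩ := (hinj.bijective_of_nat_card_le (Nat.card_addMonoidHom_zmod hR).le).2 φ
  exact ⟨c, hc.symm⟩

end Characters

end DualityDatum

variable {K : Type} [Field K] [NumberField K] {M : Type} [AddCommGroup M] [TopologicalSpace M]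
  [DiscreteTopology M] {R : Type} [CommRing R] [Module R M] [TopologicalSpace R] [DiscreteTopology R]
  {p : ℕ} [Fact p.Prime] [Algebra ℤ_[p] R] {cd : ConjugationDatum K} {ρ : DiscreteGaloisModule K M}
  (D : DualityDatum p cd ρ R) {k : ℕ}
  (lam : R →+ ZMod (p ^ k))
  (hlam : ∀ (z : ℤ_[p]) (r : R), lam (algebraMap ℤ_[p] R z * r) = PadicInt.toZModPow k z * lam r)
  (exp : ZMod (p ^ k) →+ MuCarrier K (p ^ k))
  (hexp : ∀ (g : absoluteGaloisGroup K) (x : ZMod (p ^ k)),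
    exp (cyclotomicCharacterModPow K p k g * x) = mu K (p ^ k) g (exp x))

namespace DualityDatum

/-! ## §1 The readings `H²(exp ∘ λ')` are additive in `λ'` -/

/-- The reading `H²(exp ∘ λ')` depends only on the character `λ'`, not on the proof of its semilinearity.
[cite: Howard2004HeegnerKolyvagin, §1.3 H.4 (arXiv p. 7, L78–82)] -/
theorem cohomologyMap_expLamLocalHom_congr (v : Place K) {lam₁ lam₂ : R →+ ZMod (p ^ k)} (h : lam₁ = lam₂)
    (h₁ : ∀ (z : ℤ_[p]) (r : R), lam₁ (algebraMap ℤ_[p] R z * r) = PadicInt.toZModPow k z * lam₁ r)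
    (h₂ : ∀ (z : ℤ_[p]) (r : R), lam₂ (algebraMap ℤ_[p] R z * r) = PadicInt.toZModPow k z * lam₂ r)
    (z : galoisCohomology (D.twistOne.toLocal v) 2) :
    cohomologyMap (D.expLamLocalHom lam₁ h₁ exp hexp v) 2 z = cohomologyMap (D.expLamLocalHom lam₂ h₂ exp hexp v) 2 z := by
  subst h
  rfl

include hlam in
/-- **`H²(exp ∘ λ_b)(H²(a•) z) = H²(exp ∘ λ_{b a}) z`** (`cohomologyMap_expLam_scalarMap_two` for the character `λ_b`).
[cite: Howard2004HeegnerKolyvagin, §1.3 H.4 (arXiv p. 7, L78–82)] [cite: SerreGaloisCohomology1997, I §2.2] -/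
theorem cohomologyMap_expLam_lamMul_scalarMap_two (v : Place K) (b a : R)
    (z : galoisCohomology (D.twistOne.toLocal v) 2) :
    cohomologyMap (D.expLamLocalHom (lamMul lam b) (lamMul_semilinear lam hlam b) exp hexp v) 2
        (galoisCohomology.scalarMap (D.twistOne.toLocal v) (isScalarLinear_toLocal D.isScalarLinear_twistOne v) 2 a z) =
      cohomologyMap (D.expLamLocalHom (lamMul lam (b * a)) (lamMul_semilinear lam hlam (b * a)) exp hexp v) 2 z := by
  rw [D.cohomologyMap_expLam_scalarMap_two (lamMul lam b) (lamMul_semilinear lam hlam b) exp hexp v a z]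
  exact D.cohomologyMap_expLamLocalHom_congr exp hexp v (lamMul_lamMul lam b a) _ _ z

/-- **The readings are additive in the character**: `H²(exp ∘ (λ₁ + λ₂)) z = H²(exp ∘ λ₁) z + H²(exp ∘ λ₂) z` (on a
`2`-cocycle `c` both are the class of `(σ, τ) ↦ exp λ₁(c σ τ) + exp λ₂(c σ τ)`).
[cite: SerreGaloisCohomology1997, I §2.2–2.3 (functoriality of H² in the coefficients, factor systems)] [cite: Howard2004HeegnerKolyvagin, §1.3 H.4 (arXiv p. 7, L78–82)] -/
theorem cohomologyMap_expLam_add (v : Place K) {lam₁ lam₂ : R →+ ZMod (p ^ k)}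
    (h₁ : ∀ (z : ℤ_[p]) (r : R), lam₁ (algebraMap ℤ_[p] R z * r) = PadicInt.toZModPow k z * lam₁ r)
    (h₂ : ∀ (z : ℤ_[p]) (r : R), lam₂ (algebraMap ℤ_[p] R z * r) = PadicInt.toZModPow k z * lam₂ r)
    (z : galoisCohomology (D.twistOne.toLocal v) 2) :
    cohomologyMap (D.expLamLocalHom (lam₁ + lam₂) (add_semilinear h₁ h₂) exp hexp v) 2 z =
      cohomologyMap (D.expLamLocalHom lam₁ h₁ exp hexp v) 2 z + cohomologyMap (D.expLamLocalHom lam₂ h₂ exp hexp v) 2 z := by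
  haveI : CompactSpace (absoluteGaloisGroup (Place.Completion v)) := absoluteGaloisGroup_compactSpace _
  obtain ⟨c, rfl⟩ := twoCocycleClass_surjective _ z
  rw [cohomologyMap_twoCocycleClass, cohomologyMap_twoCocycleClass, cohomologyMap_twoCocycleClass,
    ← twoCocycleClass_add]
  refine congrArg _ (Subtype.ext (ContinuousMap.ext fun στ => ?_))
  obtain ⟨σ, τ⟩ := στ
  rw [Submodule.coe_add, ContinuousMap.add_apply, pullback₂_id_resIdHom_apply, pullback₂_id_resIdHom_apply,
    pullback₂_id_resIdHom_apply]
  change exp ((lam₁ + lam₂) (c.1 (σ, τ))) = exp (lam₁ (c.1 (σ, τ))) + exp (lam₂ (c.1 (σ, τ)))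
  rw [AddMonoidHom.add_apply, map_add]

/-! ## §3 Coordinates: every class of `H²(K_v, R(1))` reads as `λ(c ·)` on the characters -/

include hlam in
/-- **Coordinates of a class**: for every `z ∈ H²(K_v, R(1))` there is `c ∈ R` with `ι H²(exp ∘ λ_b) z = λ(c b)` for
ALL `b ∈ R` (the reading `b ↦ ι H²(exp ∘ λ_b) z` is an additive character of `R`, §1, hence some `λ_c`, §2) — the
kernel form of the identification `H²(K_v, R(1)) ↪ R` through a dualizing `λ` and an injective invariant map `ι`.
[cite: Howard2004HeegnerKolyvagin, §1.3 H.4 (arXiv p. 7, L78–82: «⟨ , ⟩_v : H¹(K_v,T) × H¹(K_v̄,T) → R»)] [cite: MilneADT2006, Ch. I Cor. 2.3] -/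
theorem exists_forall_reading_eq_lam_mul [Finite R] (hR : ∀ x : R, (p ^ k) • x = 0) {ι : Type} (r : ι → R)
    (hbij : Bijective fun x : R => fun i : ι => exp (lam (r i * x))) (v : Place K)
    (ι₀ : galoisCohomology ((mu K (p ^ k)).toLocal v) 2 →+ ZMod (p ^ k))
    (z : galoisCohomology (D.twistOne.toLocal v) 2) :
    ∃ c : R, ∀ b : R,
      ι₀ (cohomologyMap (D.expLamLocalHom (lamMul lam b) (lamMul_semilinear lam hlam b) exp hexp v) 2 z) = lam (c * b) := by
  -- the reading as an additive character of `R`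
  let Φ : R →+ ZMod (p ^ k) := AddMonoidHom.mk'
    (fun b => ι₀ (cohomologyMap (D.expLamLocalHom (lamMul lam b) (lamMul_semilinear lam hlam b) exp hexp v) 2 z))
    fun b b' => by
      change ι₀ _ = ι₀ _ + ι₀ _
      rw [D.cohomologyMap_expLamLocalHom_congr exp hexp v (lamMul_add lam b b') (lamMul_semilinear lam hlam (b + b'))
        (add_semilinear (lamMul_semilinear lam hlam b) (lamMul_semilinear lam hlam b')) z,
        D.cohomologyMap_expLam_add exp hexp v (lamMul_semilinear lam hlam b) (lamMul_semilinear lam hlam b') z]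
      exact map_add ι₀ _ _
  obtain ⟨c, hc⟩ := exists_eq_lamMul lam exp hR r hbij Φ
  refine ⟨c, fun b => ?_⟩
  have := DFunLike.congr_fun hc b
  rw [lamMul_apply, AddMonoidHom.mk'_apply] at this
  exact this

include hlam in
/-- Classes with the same readings on the dualizing family are equal (family readout + `ι` injective).
[cite: Howard2004HeegnerKolyvagin, §1.3 H.4 (arXiv p. 7, L78–82)] [cite: MilneADT2006, Ch. I Cor. 2.3] -/
theorem eq_of_forall_reading_eq {ι : Type} [Finite ι] (r : ι → R)
    (hbij : Bijective fun x : R => fun i : ι => exp (lam (r i * x))) (v : Place K)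
    (ι₀ : galoisCohomology ((mu K (p ^ k)).toLocal v) 2 →+ ZMod (p ^ k)) (hι₀ : Injective ι₀)
    (z z' : galoisCohomology (D.twistOne.toLocal v) 2)
    (h : ∀ i, ι₀ (cohomologyMap (D.expLamLocalHom (lamMul lam (r i)) (lamMul_semilinear lam hlam (r i)) exp hexp v) 2 z) =
      ι₀ (cohomologyMap (D.expLamLocalHom (lamMul lam (r i)) (lamMul_semilinear lam hlam (r i)) exp hexp v) 2 z')) :
    z = z' := by
  rw [← sub_eq_zero]
  refine D.eq_zero_of_forall_cohomologyMap_expLam_lamMul_eq_zero lam hlam exp hexp r hbij v _ fun i => ?_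
  exact (map_sub _ z z').trans (sub_eq_zero.2 (hι₀ (h i)))

/-! ## §4 (hP): the `ϖ`-torsion of `H²(K_v, R(1))` has rank at most one -/

include hlam hexp in
/-- **(hP) for `P = H²(K_v, R(1))`.**  Let `R` be finite, killed by `p^k`, with a dualizing family `(r_i)` for
`(λ, exp)` and an injective `ι : H²(K_v, μ_{p^k}) → ℤ/p^k`, and suppose the `ϖ`-torsion of `R` has rank `≤ 1`
(`ϖ a = 0 → ϖ b = 0 → a ≠ 0 → ∃ c, b = c a`; e.g. `R = 𝒪/ϖ^e`).  Then for `P, Q ∈ H²(K_v, R(1))` with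
`H²(ϖ•) P = 0 = H²(ϖ•) Q` and `P ≠ 0` there is `c ∈ R` with `Q = H²(c•) P` — the hypothesis `hP` of
`LagrangianSubmodulesDeltaTransfer.forall_pow_smul_eq_zero_of_lagrangian` for the target of Howard's local pairing
(`Module` structure `r • z := galoisCohomology.scalarMap … 2 r z`).  PROOF: coordinates `c_P, c_Q` (§3); `H²(ϖ•)P = 0`
reads `λ(c_P ϖ b) = 0 ∀ b`, so `ϖ c_P = 0`; `P ≠ 0` gives `c_P ≠ 0`; `c_Q = c c_P` in `R`, and `Q`, `H²(c•)P` have the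
same readings. [cite: Howard2004HeegnerKolyvagin, §1.3 H.4 (arXiv p. 7, L78–82) and Lemma 1.5.7 (p. 10 L105–127: the R-valued pairing)] [cite: MilneADT2006, Ch. I Cor. 2.3] -/
theorem exists_eq_scalarMap_two_of_scalarMap_two_eq_zero [Finite R] (hR : ∀ x : R, (p ^ k) • x = 0)
    {ι : Type} [Finite ι] (r : ι → R) (hbij : Bijective fun x : R => fun i : ι => exp (lam (r i * x)))
    (v : Place K) (ι₀ : galoisCohomology ((mu K (p ^ k)).toLocal v) 2 →+ ZMod (p ^ k)) (hι₀ : Injective ι₀)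
    (ϖ : R) (hsoc : ∀ a b : R, ϖ * a = 0 → ϖ * b = 0 → a ≠ 0 → ∃ c : R, b = c * a)
    (P Q : galoisCohomology (D.twistOne.toLocal v) 2)
    (hP : galoisCohomology.scalarMap (D.twistOne.toLocal v) (isScalarLinear_toLocal D.isScalarLinear_twistOne v) 2 ϖ P = 0)
    (hQ : galoisCohomology.scalarMap (D.twistOne.toLocal v) (isScalarLinear_toLocal D.isScalarLinear_twistOne v) 2 ϖ Q = 0)
    (hP0 : P ≠ 0) :
    ∃ c : R, Q = galoisCohomology.scalarMap (D.twistOne.toLocal v) (isScalarLinear_toLocal D.isScalarLinear_twistOne v)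
      2 c P := by
  obtain ⟨cP, hcP⟩ := D.exists_forall_reading_eq_lam_mul lam hlam exp hexp hR r hbij v ι₀ P
  obtain ⟨cQ, hcQ⟩ := D.exists_forall_reading_eq_lam_mul lam hlam exp hexp hR r hbij v ι₀ Q
  -- readings of `H²(a•) z`: `ι H²(exp λ_b)(a • z) = λ(c_z (b a))`
  have hsm : ∀ (z : galoisCohomology (D.twistOne.toLocal v) 2) (cz : R),
      (∀ b, ι₀ (cohomologyMap (D.expLamLocalHom (lamMul lam b) (lamMul_semilinear lam hlam b) exp hexp v) 2 z) =
        lam (cz * b)) →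
      ∀ a b, ι₀ (cohomologyMap (D.expLamLocalHom (lamMul lam b) (lamMul_semilinear lam hlam b) exp hexp v) 2
        (galoisCohomology.scalarMap (D.twistOne.toLocal v) (isScalarLinear_toLocal D.isScalarLinear_twistOne v) 2 a z)) =
        lam (cz * (b * a)) := fun z cz hz a b => by
    rw [D.cohomologyMap_expLam_lamMul_scalarMap_two lam hlam exp hexp v b a z, hz (b * a)]
  -- `ϖ c_P = 0`, `ϖ c_Q = 0`
  have htors : ∀ (z : galoisCohomology (D.twistOne.toLocal v) 2) (cz : R),
      (∀ b, ι₀ (cohomologyMap (D.expLamLocalHom (lamMul lam b) (lamMul_semilinear lam hlam b) exp hexp v) 2 z) =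
        lam (cz * b)) →
      galoisCohomology.scalarMap (D.twistOne.toLocal v) (isScalarLinear_toLocal D.isScalarLinear_twistOne v) 2 ϖ z = 0 →
      ϖ * cz = 0 := fun z cz hz hz0 => by
    refine eq_zero_of_forall_lam_mul_eq_zero lam exp r hbij _ fun i => ?_
    have h := hsm z cz hz ϖ (r i)
    rw [hz0] at h
    rw [show r i * (ϖ * cz) = cz * (r i * ϖ) by ring]
    exact h.symm.trans ((congrArg ι₀ (map_zero _)).trans (map_zero ι₀))
  have hϖP := htors P cP hcP hP
  have hϖQ := htors Q cQ hcQ hQ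
  -- `c_P ≠ 0`
  have hcP0 : cP ≠ 0 := by
    intro h0
    apply hP0
    refine D.eq_of_forall_reading_eq lam hlam exp hexp r hbij v ι₀ hι₀ P 0 fun i => ?_
    rw [hcP, h0, zero_mul, map_zero]
    exact ((congrArg ι₀ (map_zero _)).trans (map_zero ι₀)).symm
  -- `c_Q = c c_P`
  obtain ⟨c, hc⟩ := hsoc cP cQ hϖP hϖQ hcP0
  refine ⟨c, D.eq_of_forall_reading_eq lam hlam exp hexp r hbij v ι₀ hι₀ _ _ fun i => ?_⟩
  rw [hcQ, hsm P cP hcP c (r i), hc]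
  congr 1
  ring

end DualityDatum

end Literature.NumberTheory.GaloisCohomology.Howard2004

end
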